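import Summits.PneNP.PneNP.Theses.ConvexRankGates
import Literature.Computability.Complexity.ExtMonotoneGRankSupport

/-!
# `Capture` (stmt-PneNP-2659, route PneNP/ConvexRankGates) — negative-side lemmas: structure of the wide gates

Standing-adversary (cdisprove, gen 2) output for the crux
`Summit.PneNP.PneNP.Theses.ConvexRankGates.Capture`, gate-structure part (where a refutation or a proof
has to look):

* §1 `no_zmod_primePow_embedding` — the PERM door AS TYPED: a permutation of `d` points has an element of
  order `p^k` in its cyclic group only if `p^k ≤ d` (cycle type), so `ℤ/p^k ↪̸ Sym(d)` for `d < p^k`. The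
  natural one-gate capture of the route's third-door candidate LIN-UNSAT over `ℤ/2^{n^ε}` (Fredholm over the
  self-injective ring `ℤ/2^k`) needs `s ≥ 2^{n^ε}`; this obstructs the homomorphic embedding only.
* §2 `grank_local`, `IsGRankGate.local`, `and_not_isGRankGate` — GRANK gates are LOCAL: every minterm of a
  `GRANK_s` gate has `≤ min θ d ≤ s` wires (the pencil `K₀ + ∑ Xᵢ Kᵢ` is affine-linear, so its `θ`-minors
  have total degree `≤ θ`; Edmonds' support criterion `le_rank_symbolicMatrix_iff`). `∧_k ∉ GRANK_s`,
  `s < k`.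
* §3 `perm_local`, `IsPermGate.local` — PERM gates are LOCAL: a minterm with `r` wires yields a strict
  chain of `r` subgroups of `Sym(d)`, so `2^r ≤ d! ≤ s!`.

So in `B_s` all LARGE-minterm power is convex (`∧_k ∈ CONV₁`) and all non-convex power is `s log s`-local;
for FIXED width the PERM/GRANK gates are polynomial-size monotone DNFs of their wires. Companions: `LoadBearing.lean`, `BoundedFanIn.lean`. Refuter seat cdisprove-stmt-PneNP-2659-g2, 2026-08-16.
-/

namespace Summit.PneNP.PneNP.Theorems.Capture.Negative

open Literature.Computability.Complexity MvPolynomial Finset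

/-! ## §1 The PERM door as typed: `Sym(d)` hosts an element of order `p^k` only if `p^k ≤ d` -/

/-- A prime power dividing the `lcm` of a multiset of naturals divides a member. [folklore] -/
theorem exists_mem_prime_pow_dvd_of_dvd_lcm {p k : ℕ} (hp : p.Prime) (hk : 0 < k) :
    ∀ (s : Multiset ℕ), p ^ k ∣ s.lcm → ∃ a ∈ s, p ^ k ∣ a := by
  intro s
  induction s using Multiset.induction_on with
  | empty =>
    intro h
    rw [Multiset.lcm_zero] at h
    exact absurd (Nat.dvd_one.1 h) (ne_of_gt (Nat.one_lt_pow hk.ne' hp.one_lt))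
  | cons a s ih =>
    intro h
    rw [Multiset.lcm_cons] at h
    by_cases ha : a = 0
    · exact ⟨a, Multiset.mem_cons_self a s, ha ▸ dvd_zero _⟩
    by_cases hs : s.lcm = 0
    · obtain ⟨b, hb, hbd⟩ := ih (hs ▸ dvd_zero _)
      exact ⟨b, Multiset.mem_cons_of_mem hb, hbd⟩
    have hl : Nat.lcm a s.lcm ≠ 0 := Nat.lcm_ne_zero ha hs
    have hle := (hp.pow_dvd_iff_le_factorization hl).1 h
    rw [Nat.factorization_lcm ha hs, Finsupp.sup_apply] at hle
    rcases le_sup_iff.1 hle with h1 | h1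
    · exact ⟨a, Multiset.mem_cons_self a s, (hp.pow_dvd_iff_le_factorization ha).2 h1⟩
    · obtain ⟨b, hb, hbd⟩ := ih ((hp.pow_dvd_iff_le_factorization hs).2 h1)
      exact ⟨b, Multiset.mem_cons_of_mem hb, hbd⟩

/-- **Order obstruction.** If a prime power `p^k` (`k ≥ 1`) divides the order of a permutation of `d`
points then `p^k ≤ d`: `p^k` divides the `lcm` of the cycle type, hence some cycle length, and the cycle
lengths sum to at most `d`. [folklore] -/
theorem prime_pow_le_of_dvd_orderOf_perm {d p k : ℕ} (hp : p.Prime) (hk : 0 < k)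
    (σ : Equiv.Perm (Fin d)) (h : p ^ k ∣ orderOf σ) : p ^ k ≤ d := by
  rw [← Equiv.Perm.lcm_cycleType] at h
  obtain ⟨c, hc, hcd⟩ := exists_mem_prime_pow_dvd_of_dvd_lcm hp hk _ h
  have hcpos : 0 < c := lt_of_lt_of_le two_pos (Equiv.Perm.two_le_of_mem_cycleType hc)
  calc p ^ k ≤ c := Nat.le_of_dvd hcpos hcd
    _ ≤ σ.cycleType.sum := Multiset.le_sum_of_mem hc
    _ = σ.support.card := Equiv.Perm.sum_cycleType σ
    _ ≤ Fintype.card (Fin d) := Finset.card_le_univ _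
    _ = d := Fintype.card_fin d

/-- Hence a group embedding into `Sym(d)` an element of order `p^k` forces `p^k ≤ d`. [folklore] -/
theorem prime_pow_le_of_injective_hom {G : Type*} [Group G] {d p k : ℕ} (hp : p.Prime) (hk : 0 < k)
    (φ : G →* Equiv.Perm (Fin d)) (hφ : Function.Injective φ) (g : G) (hg : orderOf g = p ^ k) :
    p ^ k ≤ d :=
  prime_pow_le_of_dvd_orderOf_perm hp hk (φ g) (by rw [orderOf_injective φ hφ g, hg])

/-- **`ℤ/p^k` does not embed in `Sym(d)` for `d < p^k`.** This is the backbone of the third-door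
objection to the crux AS TYPED (route KILL CRITERIA; refuter passes A/C 2026-08-15): the natural one-gate
capture of LIN-UNSAT over `ℤ/2^k` (Fredholm: unsolvable iff `(0,…,0,2^{k-1})` lies in the additive subgroup
generated by the selected augmented rows) needs the group `(ℤ/2^k)^{D+1}` INSIDE a PERM gate, i.e. inside
`Sym(d)` with `d ≤ s`; for `k = n^ε` this forces `s ≥ 2^{n^ε}`. It obstructs the homomorphic embedding
only — a PERM gate is not required to act through a homomorphism of the row group, so this is NOT a lower
bound for LIN-UNSAT against one PERM gate (that one-gate question stays open; see §3 for why locality does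
not settle it either). [folklore] -/
theorem no_zmod_primePow_embedding {d p k : ℕ} (hp : p.Prime) (hk : 0 < k) (hd : d < p ^ k) :
    ¬ ∃ φ : Multiplicative (ZMod (p ^ k)) →* Equiv.Perm (Fin d), Function.Injective φ := by
  rintro ⟨φ, hφ⟩
  have h1 : orderOf (Multiplicative.ofAdd (1 : ZMod (p ^ k))) = p ^ k := by
    rw [orderOf_ofAdd_eq_addOrderOf, ZMod.addOrderOf_one]
  exact absurd (prime_pow_le_of_injective_hom hp hk φ hφ _ h1) (not_le.2 hd)

/-- The case of the route's candidate door: no `ℤ/2^k ↪ Sym(d)` when `d < 2^k`. [folklore] -/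
theorem no_zmod_two_pow_embedding {d k : ℕ} (hk : 0 < k) (hd : d < 2 ^ k) :
    ¬ ∃ φ : Multiplicative (ZMod (2 ^ k)) →* Equiv.Perm (Fin d), Function.Injective φ :=
  no_zmod_primePow_embedding Nat.prime_two hk hd

/-! ## §2 GRANK gates are LOCAL: every minterm of a GRANK gate of dimension `d` has at most `d` wires -/

section GRankLocal

variable {F : Type*} [Field F] {n d : ℕ}

/-- The entries of the generic symbolic matrix `K₀ + ∑ Xᵢ Kᵢ` are affine-linear in `X`. [folklore] -/
theorem totalDegree_symbolicPolyMatrix_apply_le (K₀ : Matrix (Fin d) (Fin d) F)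
    (K : Fin n → Matrix (Fin d) (Fin d) F) (a b : Fin d) :
    (symbolicPolyMatrix K₀ K a b).totalDegree ≤ 1 := by
  simp only [symbolicPolyMatrix, Matrix.add_apply, Matrix.map_apply, Matrix.sum_apply,
    Matrix.smul_apply, smul_eq_mul]
  refine (totalDegree_add _ _).trans (max_le ?_ ?_)
  · rw [totalDegree_C]; exact zero_le_one
  · refine (totalDegree_finsetSum _ _).trans (Finset.sup_le fun i _ => ?_)
    refine (totalDegree_mul _ _).trans ?_
    rw [totalDegree_X, totalDegree_C]

/-- Signs do not raise the total degree. [folklore] -/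
theorem totalDegree_units_smul_le (u : ℤˣ) (p : MvPolynomial (Fin n) F) :
    (u • p).totalDegree ≤ p.totalDegree := by
  rcases Int.units_eq_one_or u with rfl | rfl
  · rw [one_smul]
  · rw [Units.neg_smul, one_smul, totalDegree_neg]

/-- A determinant of affine-linear entries has total degree at most its order. [folklore] -/
theorem totalDegree_det_le {ι : Type*} [Fintype ι] [DecidableEq ι]
    (M : Matrix ι ι (MvPolynomial (Fin n) F)) (hM : ∀ a b, (M a b).totalDegree ≤ 1) :
    M.det.totalDegree ≤ Fintype.card ι := by
  rw [Matrix.det_apply]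
  refine (totalDegree_finsetSum _ _).trans (Finset.sup_le fun σ _ => ?_)
  refine (totalDegree_units_smul_le _ _).trans ?_
  refine (totalDegree_finsetProd _ _).trans ?_
  calc ∑ i, (M (σ i) i).totalDegree ≤ ∑ _i : ι, 1 := Finset.sum_le_sum fun i _ => hM _ _
    _ = Fintype.card ι := by simp

/-- The `θ × θ` minors of the generic symbolic matrix have total degree `≤ θ`. [folklore] -/
theorem totalDegree_minor_le (K₀ : Matrix (Fin d) (Fin d) F) (K : Fin n → Matrix (Fin d) (Fin d) F)
    {θ : ℕ} (r c : Fin θ → Fin d) :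
    (((symbolicPolyMatrix K₀ K).submatrix r c).det).totalDegree ≤ θ := by
  have := totalDegree_det_le ((symbolicPolyMatrix K₀ K).submatrix r c)
    fun a b => totalDegree_symbolicPolyMatrix_apply_le K₀ K (r a) (c b)
  simpa using this

/-- A monomial of `P` involves at most `totalDegree P` variables. [folklore] -/
theorem card_support_le_totalDegree {P : MvPolynomial (Fin n) F} {m : Fin n →₀ ℕ}
    (hm : m ∈ P.support) : m.support.card ≤ P.totalDegree := by
  refine le_trans ?_ (le_totalDegree hm)
  rw [Finsupp.sum, Finset.card_eq_sum_ones]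
  exact Finset.sum_le_sum fun i hi => Nat.one_le_iff_ne_zero.2 (Finsupp.mem_support_iff.1 hi)

/-- A non-vanishing `θ × θ` minor has distinct rows, so `θ ≤ d`. [folklore] -/
theorem le_of_minor_support_nonempty (K₀ : Matrix (Fin d) (Fin d) F)
    (K : Fin n → Matrix (Fin d) (Fin d) F) {θ : ℕ} (r c : Fin θ → Fin d) {m : Fin n →₀ ℕ}
    (hm : m ∈ (((symbolicPolyMatrix K₀ K).submatrix r c).det).support) : θ ≤ d := by
  have hr : Function.Injective r := by
    intro i j hij
    by_contra hne
    have h0 : ((symbolicPolyMatrix K₀ K).submatrix r c).det = 0 :=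
      Matrix.det_zero_of_row_eq hne (funext fun b => by simp [Matrix.submatrix_apply, hij])
    rw [h0, support_zero] at hm
    exact absurd hm (Finset.notMem_empty _)
  simpa using Fintype.card_le_of_injective r hr

/-- **GRANK locality (matrix form).** If the generic rank of `K₀ + ∑_{vᵢ=1} Xᵢ Kᵢ` is at least `θ`,
then already a sub-selection `t ⊆ {i | vᵢ = 1}` of AT MOST `min θ d` wires achieves rank `≥ θ`: a
non-vanishing `θ`-minor has a surviving monomial (Edmonds: `le_rank_symbolicMatrix_iff`), that monomial
has total degree `≤ θ` (affine-linear entries), and switching on exactly its variables keeps it.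
[folklore] -/
theorem grank_local (K₀ : Matrix (Fin d) (Fin d) F) (K : Fin n → Matrix (Fin d) (Fin d) F) (θ : ℕ)
    (v : Fin n → Bool) (h : θ ≤ (symbolicMatrix K₀ K v).rank) :
    ∃ t : Finset (Fin n), t.card ≤ θ ∧ t.card ≤ d ∧ (∀ i ∈ t, v i = true) ∧
      θ ≤ (symbolicMatrix K₀ K (fun i => decide (i ∈ t))).rank := by
  rw [le_rank_symbolicMatrix_iff] at h
  obtain ⟨r, c, m, hm, hv⟩ := h
  refine ⟨m.support, (card_support_le_totalDegree hm).trans (totalDegree_minor_le K₀ K r c),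
    (card_support_le_totalDegree hm).trans
      ((totalDegree_minor_le K₀ K r c).trans (le_of_minor_support_nonempty K₀ K r c hm)), hv, ?_⟩
  rw [le_rank_symbolicMatrix_iff]
  exact ⟨r, c, m, hm, fun i hi => by simpa using hi⟩

end GRankLocal

/-- **GRANK gates are `s`-local.** Every accepted input of a GRANK gate of size parameter `s` contains an
accepted sub-input with at most `s` wires switched on; equivalently every MINTERM of a `GRANK_s` gate has
at most `s` elements (in fact `≤ min θ d`). So a single GRANK gate computing a monotone `f` needs dimension
`d ≥` the largest minterm of `f` (`∧_k` needs `d ≥ k`; Edmonds' perfect-matching gate has `d = n` for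
minterms of size `n`), and for FIXED `d` a GRANK gate of fan-in `k` is a monotone DNF with `≤ (k+1)^d`
terms: all super-polynomial power of GRANK sits in GROWING dimension, through cancellations among
`≤ d`-subsets. [folklore] -/
theorem IsGRankGate.local {s : ℕ} {g : GateFn} (hg : IsGRankGate s g) (v : Fin g.1 → Bool)
    (hv : g.2 v = true) :
    ∃ t : Finset (Fin g.1), t.card ≤ s ∧ (∀ i ∈ t, v i = true) ∧
      g.2 (fun i => decide (i ∈ t)) = true := by
  obtain ⟨F, _, d, θ, hd, K₀, K, hgate⟩ := hg
  obtain ⟨t, -, htd, htv, ht⟩ := grank_local K₀ K θ v ((hgate v).1 hv)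
  exact ⟨t, htd.trans hd, htv, (hgate _).2 ht⟩

/-- In particular `∧_k` (all `k` wires must be on) is not a GRANK gate of dimension `< k`. [folklore] -/
theorem and_not_isGRankGate {k s : ℕ} (hs : s < k) : ¬ IsGRankGate s (GateFn.and k) := by
  intro h
  obtain ⟨t, hts, -, ht⟩ := IsGRankGate.local h (fun _ => true) (by simp [GateFn.and])
  have hall : ∀ i, i ∈ t := by simpa [GateFn.and] using ht
  have htu : t = Finset.univ := Finset.eq_univ_iff_forall.2 hall
  have hk : t.card = k := by rw [htu, Finset.card_univ]; exact Fintype.card_fin k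
  omega

/-! ## §3 PERM gates are LOCAL too: a minterm with `r` wires forces `2^r ≤ d!` -/

section PermLocal

variable {n d : ℕ}

/-- Independent generator families double the subgroup at each step: if no `σᵢ, i ∈ T` lies in the
subgroup generated by the others, then `2^{#T} ≤ |⟨σᵢ : i ∈ T⟩|`. [folklore] -/
theorem two_pow_card_le_card_closure (σ : Fin n → Equiv.Perm (Fin d)) :
    ∀ T : Finset (Fin n), (∀ i ∈ T, σ i ∉ Subgroup.closure (σ '' ↑(T.erase i))) →
      2 ^ T.card ≤ Nat.card (Subgroup.closure (σ '' (↑T : Set (Fin n)))) := by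
  classical
  intro T
  induction T using Finset.induction_on with
  | empty =>
    intro _
    simp only [Finset.card_empty, pow_zero]
    exact Nat.card_pos
  | insert a T ha ih =>
    intro hind
    have hT : ∀ i ∈ T, σ i ∉ Subgroup.closure (σ '' ↑(T.erase i)) := by
      intro i hi hmem
      refine hind i (Finset.mem_insert_of_mem hi) (Subgroup.closure_mono (Set.image_mono ?_) hmem)
      intro j hj
      simp only [Finset.coe_erase, Set.mem_sdiff, Finset.mem_coe, Set.mem_singleton_iff,
        Finset.coe_insert, Set.mem_insert_iff] at hj ⊢
      exact ⟨Or.inr hj.1, hj.2⟩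
    have hσa : σ a ∉ Subgroup.closure (σ '' (↑T : Set (Fin n))) := by
      have := hind a (Finset.mem_insert_self a T)
      rwa [Finset.erase_insert ha] at this
    set H := Subgroup.closure (σ '' (↑T : Set (Fin n))) with hH
    set H' := Subgroup.closure (σ '' (↑(insert a T) : Set (Fin n))) with hH'
    have hle : H ≤ H' := Subgroup.closure_mono (Set.image_mono (by simp))
    have hmem : σ a ∈ H' := Subgroup.subset_closure ⟨a, by simp, rfl⟩
    have hne : Nat.card H ≠ Nat.card H' := by
      intro hc
      have : H = H' := Subgroup.eq_of_le_of_card_ge hle hc.ge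
      exact hσa (this ▸ hmem)
    have hdvd : Nat.card H ∣ Nat.card H' := Subgroup.card_dvd_of_le hle
    obtain ⟨q, hq⟩ := hdvd
    have hq2 : 2 ≤ q := by
      rcases Nat.lt_or_ge q 2 with hlt | hge
      · interval_cases q
        · rw [mul_zero] at hq; exact absurd hq (Nat.card_pos (α := H')).ne'
        · rw [mul_one] at hq; exact absurd hq.symm hne
      · exact hge
    calc 2 ^ (insert a T).card = 2 ^ T.card * 2 := by rw [Finset.card_insert_of_notMem ha, pow_succ]
      _ ≤ Nat.card H * q := Nat.mul_le_mul (ih hT) hq2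
      _ = Nat.card H' := hq.symm

/-- **PERM locality (group form).** If `τ ∈ ⟨σᵢ : i ∈ T⟩` but `τ ∉ ⟨σᵢ : i ∈ T ∖ {j}⟩` for every
`j ∈ T` (i.e. `T` is a MINTERM of the PERM gate `(σ, τ)` on `d` points), then `2^{#T} ≤ d!`: the chain of
subgroups along `T` is strict (a non-strict step would make that generator redundant) and each strict
step at least doubles the order (Lagrange). Hence minterms of a `PERM_s` gate have `≤ log₂ (s!) < s log₂ s`
wires. [folklore] -/
theorem perm_local (σ : Fin n → Equiv.Perm (Fin d)) (τ : Equiv.Perm (Fin d)) (T : Finset (Fin n))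
    (hT : τ ∈ Subgroup.closure (σ '' (↑T : Set (Fin n))))
    (hmin : ∀ j ∈ T, τ ∉ Subgroup.closure (σ '' ↑(T.erase j))) :
    2 ^ T.card ≤ d.factorial := by
  classical
  have hind : ∀ i ∈ T, σ i ∉ Subgroup.closure (σ '' ↑(T.erase i)) := by
    intro i hi hmem
    refine hmin i hi ((Subgroup.closure_le _).2 ?_ hT)
    rintro _ ⟨j, hj, rfl⟩
    by_cases hji : j = i
    · subst hji; exact hmem
    · exact Subgroup.subset_closure ⟨j, by simp [hji, hj], rfl⟩
  calc 2 ^ T.card ≤ Nat.card (Subgroup.closure (σ '' (↑T : Set (Fin n)))) :=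
        two_pow_card_le_card_closure σ T hind
    _ ≤ Nat.card (Equiv.Perm (Fin d)) := Subgroup.card_le_card_group _
    _ = d.factorial := by rw [Nat.card_eq_fintype_card, Fintype.card_perm, Fintype.card_fin]

/-- **PERM gates are local.** Every accepted input of a PERM gate on `d ≤ s` points contains an accepted
sub-input `t` with `2^{#t} ≤ s!`, i.e. every minterm of a `PERM_s` gate has at most `log₂ (s!) ≤ s log₂ s`
wires. (Contrast: `∧_k ∈ CONV₁` for every `k` — in the extended basis all LARGE-minterm power is convex.)
Consequence for the third door (§1): locality does NOT obstruct LIN-UNSAT over `ℤ/2^k` as one PERM gate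
(its minterms — minimal unsolvable subsystems — have `≤ k(D+1)` rows); only the homomorphic embedding is
excluded, so that one-gate question remains open. [folklore] -/
theorem IsPermGate.local {s : ℕ} {g : GateFn} (hg : IsPermGate s g) (v : Fin g.1 → Bool)
    (hv : g.2 v = true) :
    ∃ t : Finset (Fin g.1), 2 ^ t.card ≤ s.factorial ∧ (∀ i ∈ t, v i = true) ∧
      g.2 (fun i => decide (i ∈ t)) = true := by
  classical
  obtain ⟨d, hd, σ, τ, hgate⟩ := hg
  -- accepted sub-selections of the on-wires, and one of minimal cardinality
  set S : Finset (Finset (Fin g.1)) := (Finset.univ.filter fun i => v i = true).powerset.filter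
    fun t => τ ∈ Subgroup.closure (σ '' (↑t : Set (Fin g.1))) with hS
  have hSne : S.Nonempty := by
    refine ⟨Finset.univ.filter fun i => v i = true, ?_⟩
    simp only [hS, Finset.mem_filter, Finset.mem_powerset, Finset.Subset.refl, true_and]
    have := (hgate v).1 hv
    convert this using 3
    ext i; simp
  obtain ⟨t, htS, htmin⟩ := S.exists_min_image Finset.card hSne
  simp only [hS, Finset.mem_filter, Finset.mem_powerset] at htS
  obtain ⟨htsub, ht⟩ := htS
  have hmin : ∀ j ∈ t, τ ∉ Subgroup.closure (σ '' ↑(t.erase j)) := by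
    intro j hj hmem
    have hmemS : t.erase j ∈ S := by
      simp only [hS, Finset.mem_filter, Finset.mem_powerset]
      exact ⟨(Finset.erase_subset j t).trans htsub, hmem⟩
    have := htmin _ hmemS
    rw [Finset.card_erase_of_mem hj] at this
    have hpos : 0 < t.card := Finset.card_pos.2 ⟨j, hj⟩
    omega
  refine ⟨t, (perm_local σ τ t ht hmin).trans (Nat.factorial_le hd), fun i hi => ?_, ?_⟩
  · have := htsub hi
    simpa using this
  · rw [hgate]
    convert ht using 3
    ext i; simp

end PermLocal

end Summit.PneNP.PneNP.Theorems.Capture.Negative
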